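import Literature.AnabelianGeometry.EtaleTheta.RealificationFunctor
import Literature.AlgebraicGeometry.Frobenioids.RlfPrimes
import Literature.AlgebraicGeometry.Frobenioids.PerfFactorialSplitting
import Literature.AlgebraicGeometry.Frobenioids.ElementaryFrobenioid
import HarnessLib

/-!
# Frobenioids I, Proposition 5.5 (iii): "`Φ` non-dilating ⇒ `Φ^rlf` non-dilating"

Mochizuki, *The geometry of Frobenioids I: the general theory*, Kyushu J. Math. **62** (2008)
293–400, §5, proof of Proposition 5.5 (iii), p. 105 l. 26 ("it follows immediately from the
definitions that `Φ^rlf` is non-dilating [if `Φ` is]"), with Def. 1.1 (i)/(ii) p. 19 (non-dilating)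
and Def. 2.4 (i) pp. 47–48 (`M → M^pf → M^rlf ⊆ ∏_𝔮 M^rlf_𝔮`). [cite: MochizukiFrdI2008, Prop. 5.5 (iii) p.104]

Proof-only companion (cell abc-iut, sub-DAG S7 row `FrdI:Prop5.5(iii)/P55-L07`, input (N) of the
standard-type half, seat abc-iut-w4-d084). The argument, for a perf-factorial monoid `M` and an
endomorphism `α` with realification `α^rlf` (the unique endomorphism of `M^rlf` over `α^pf`):
* `M → M^rlf` reflects `≼` (`IsPerfFactorial.precsim_of_toRealification_precsim`): compare the primary
  factorizations prime by prime — each `M^pf_𝔮` is monoprime (divisibility total) and embeds into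
  `M^rlf_𝔮 = M^pf_𝔮 ⊗ ℝ_{≥0}` — and conclude by Def. 2.4 (i)(d);
* `M → M^rlf` maps primary elements to primary elements (their factorization is supported at one prime);
* hence "`α^rlf(a) ≼ a` for all primary `a ∈ M^rlf`" forces "`α(m) ≼ m` for all primary `m ∈ M`", so
  `α = id` (`α` non-dilating, `M` sharp), so `α^rlf = id` by the uniqueness in the universal property
  of `M^rlf` (`RlfUniversal.map_id`); in particular `α^rlf` is non-dilating.
Applied objectwise this gives `IsNonDilatingOn Φ → IsNonDilatingOn Φ^rlf` for a perf-factorial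
divisorial monoid `Φ` on `D`. No statement of the paper is strengthened; nothing here bears on
[IUTchIII] Cor. 3.12.
-/

namespace Literature.AlgebraicGeometry.Frobenioids

open CategoryTheory Opposite

universe w v u

section Monoid

variable {M : Type u} [CommMonoid M]

/-- In a sharp monoid `Associates.mk : N → N^char` is injective. [cite: MochizukiFrdI2008, §0 p.11] -/
private theorem mk_injective_of_isSharp' {N : Type u} [CommMonoid N] (hN : IsSharp N) :
    Function.Injective (Associates.mk : N → Associates N) := by
  intro a b h
  obtain ⟨u, hu⟩ := Associates.mk_eq_mk_iff_associated.mp h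
  rw [hN.eq_one_of_isUnit _ u.isUnit, mul_one] at hu
  exact hu

/-- In a sharp monoid an element is primary iff its class in `N^char = N` is (`N → N^char` is a
multiplicative bijection). [cite: MochizukiFrdI2008, §0 p.12] -/
private theorem isPrimary_mk_iff_of_isSharp {N : Type u} [CommMonoid N] (hN : IsSharp N) (a : N) :
    IsPrimary (Associates.mk a) ↔ IsPrimary a := by
  let e : N ≃* Associates N := MulEquiv.ofBijective (Associates.mkMonoidHom (M := N))
    ⟨mk_injective_of_isSharp' hN, Associates.mk_surjective⟩
  exact isPrimary_map_iff e

/-- `N → N^char` reflects `≼` (in any commutative monoid). [cite: MochizukiFrdI2008, §0 p.12] -/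
private theorem precsim_of_mk_precsim_mk {N : Type u} [CommMonoid N] {a b : N}
    (h : Associates.mk a ≼ Associates.mk b) : a ≼ b := by
  obtain ⟨n, hn, hdvd⟩ := h
  rw [← Associates.mk_pow, Associates.mk_dvd_mk] at hdvd
  exact ⟨n, hn, hdvd⟩

/-- **`M^pf → M^rlf` reflects `≼`** for a perf-factorial `M`: if `a ≼ b` in `M^rlf` (i.e. `a_𝔮 ≤ n · b_𝔮`
in every `M^rlf_𝔮`), then, writing the factorizations of `a` and `n · b` inside `∏_𝔮 M^pf_𝔮`
(Def. 2.4 (i)(c)) and using that each `M^pf_𝔮` is monoprime and embeds into `M^rlf_𝔮`, one gets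
`a ≤ n · b` inside `M^pf_factor`, hence in `M^pf` (Def. 2.4 (i)(d)). [cite: MochizukiFrdI2008, Def. 2.4(i) p.47] -/
theorem IsPerfFactorial.precsim_of_toRealification_precsim (h : IsPerfFactorial M) {a b : Perfection M}
    (hab : h.toRealification a ≼ h.toRealification b) : a ≼ b := by
  obtain ⟨n, hn, hdvd⟩ := (IsPerfFactorial.Rlf.precsim_iff h _ _).mp hab
  have hca : ((h.toRealification a : h.Rlf) : RlfFactor M) = factorMap M a := rfl
  have hcb : ((h.toRealification b : h.Rlf) : RlfFactor M) = factorMap M b := rfl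
  rw [hca, hcb] at hdvd
  obtain ⟨xa, hxa⟩ := h.factorMap_mem_range a
  obtain ⟨xb, hxb⟩ := h.factorMap_mem_range (b ^ n)
  have hbn : factorMap M (b ^ n) = factorMap M b ^ n := map_pow h.factorHom b n
  have hmono : ∀ 𝔮 : Primes (Perfection M), IsMonoprime (PfAt M 𝔮) := fun 𝔮 =>
    isMonoprime_submonoid_primes_perfection h.isDivisorial.isSharp h.isMonoprime 𝔮
  have hq : ∀ 𝔮, xa 𝔮 ∣ xb 𝔮 := by
    intro 𝔮
    have h1 : Realification.of (PfAt M 𝔮) (xa 𝔮) ∣ Realification.of (PfAt M 𝔮) (xb 𝔮) := by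
      rw [← pfFactorToRlfFactor_apply M xa 𝔮, ← pfFactorToRlfFactor_apply M xb 𝔮, hxa, hxb, hbn]
      exact hdvd 𝔮
    rcases (hmono 𝔮).dvd_total (xa 𝔮) (xb 𝔮) with h2 | h2
    · exact h2
    · rw [Realification.of_injective (hmono 𝔮)
        (Realification.dvd_antisymm h1 (Realification.of_dvd h2))]
  choose c hc using hq
  refine ⟨n, hn, h.dvd_of_factorMap_mul_eq (x := c) ?_⟩
  rw [← hxa, ← hxb, ← map_mul]
  congr 1
  funext 𝔮
  rw [Pi.mul_apply, hc 𝔮]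

/-- **`M → M^rlf` maps primary elements to primary elements** (perf-factorial `M`): the factorization of
a primary `m` is supported exactly at the prime of `m` (Def. 2.4 (i)(c)), and the primary elements of
`M^rlf` are those supported at a single prime. [cite: MochizukiFrdI2008, Def. 2.4(i) p.48] -/
theorem IsPerfFactorial.isPrimary_toRealification_of (h : IsPerfFactorial M) {m : M} (hm : IsPrimary m) :
    IsPrimary (h.toRealification (Perfection.of M m)) := by
  have hpf : IsPrimary (Perfection.of M m) :=
    (Perfection.isPrimary_of_iff h.isDivisorial.isSharp).mpr hm
  have hmem : Perfection.of M m ∈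
      Primes.carrier (Quotient.mk (primarySetoid (Perfection M)) ⟨_, hpf⟩) :=
    mem_carrier_mk_of_isPrimary hpf
  refine (IsPerfFactorial.Rlf.isPrimary_iff h _).mpr
    ⟨Quotient.mk (primarySetoid (Perfection M)) ⟨_, hpf⟩, Set.Subset.antisymm ?_ ?_⟩
  · intro 𝔮' h𝔮'
    by_contra hne
    exact h𝔮' (factorMap_apply_of_ne M hmem hne)
  · rintro 𝔮' rfl
    exact h.mem_supp_factorMap_of_mem_carrier hmem

/-- **The realification of a non-dilating endomorphism is non-dilating** (Def. 1.1 (i) for `α` and for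
`α^rlf`, the endomorphism of `M^rlf` over `α^pf`; "it follows immediately from the definitions",
Prop. 5.5 (iii) p. 105 l. 26): if `α^rlf(a) ≼ a` for all primary `a ∈ M^rlf`, then `α(m) ≼ m` for all
primary `m ∈ M` (`M → M^rlf` preserves primaries and reflects `≼`), so `α = id` (`α` non-dilating,
`M = M^char` sharp), so `α^rlf = id` (uniqueness in the universal property of `M^rlf`).
[cite: MochizukiFrdI2008, Prop. 5.5 (iii) p.104] -/
theorem IsPerfFactorial.isNonDilating_rlf_of (h : IsPerfFactorial M) {α : M →* M}
    (hα : IsNonDilating α) {F : h.Rlf →* h.Rlf}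
    (hF : F.comp h.toRealification = h.toRealification.comp (Perfection.map α)) :
    IsNonDilating F := by
  intro hle
  have hsharp : IsSharp M := h.isDivisorial.isSharp
  -- Step 1: `α m ≼ m` for every primary `m ∈ M`.
  have hαle : ∀ m : M, IsPrimary m → α m ≼ m := by
    intro m hm
    have hprim : IsPrimary (Associates.mk (h.toRealification (Perfection.of M m))) :=
      (isPrimary_mk_iff_of_isSharp (IsPerfFactorial.Rlf.isSharp h) _).mpr
        (h.isPrimary_toRealification_of hm)
    have h1 := hle _ hprim
    rw [associatesMap_mk] at h1
    have h2 : F (h.toRealification (Perfection.of M m)) ≼ h.toRealification (Perfection.of M m) :=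
      precsim_of_mk_precsim_mk h1
    have h3 : F (h.toRealification (Perfection.of M m)) =
        h.toRealification (Perfection.of M (α m)) := by
      have e := DFunLike.congr_fun hF (Perfection.of M m)
      rw [MonoidHom.comp_apply, MonoidHom.comp_apply] at e
      rw [e]
      rfl
    rw [h3] at h2
    exact Perfection.of_precsim_of_iff.mp (h.precsim_of_toRealification_precsim h2)
  -- Step 2: `α = id` (non-dilation of `α`, sharpness of `M`).
  have hchar := hα (fun a ha => by
    obtain ⟨x, rfl⟩ := Associates.mk_surjective a
    rw [associatesMap_mk]
    exact (hαle x ((isPrimary_mk_iff_of_isSharp hsharp x).mp ha)).map Associates.mkMonoidHom)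
  have hαid : α = MonoidHom.id M := by
    ext x
    have h1 := congrArg (fun g => g (Associates.mk x)) hchar
    simp only [associatesMap_mk, MonoidHom.id_apply] at h1
    exact mk_injective_of_isSharp' hsharp h1
  -- Step 3: `F = id` by the universal property of `M^rlf`, hence `F^char = id`.
  subst hαid
  have hFid : F = MonoidHom.id _ :=
    Literature.AnabelianGeometry.EtaleTheta.RlfUniversal.map_id h h.supports_rlf_R F hF
  subst hFid
  ext a
  obtain ⟨x, rfl⟩ := Associates.mk_surjective a
  rfl

end Monoid

section Functor

open Literature.AnabelianGeometry.EtaleTheta (rlfFunctor rlfMap rlfMap_comp_toRealification)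

variable {D : Type u} [Category.{v} D] (Φ : Dᵒᵖ ⥤ CommMonCat.{w})
  (hΦ : ∀ X : Dᵒᵖ, IsPerfFactorial (Φ.obj X))

/-- **"If `Φ` is non-dilating, then so is `Φ^rlf`"** (proof of Prop. 5.5 (iii), p. 105 l. 26; Def. 1.1
(ii)): every `(Φ^rlf)(f) = Φ(f)^rlf` for an endomorphism `f` of the base is non-dilating as soon as
`Φ(f)` is. [cite: MochizukiFrdI2008, Prop. 5.5 (iii) p.104] -/
theorem isNonDilatingOn_rlfFunctor (hnd : IsNonDilatingOn Φ) : IsNonDilatingOn (rlfFunctor Φ hΦ) :=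
  fun A f => (hΦ (op A)).isNonDilating_rlf_of (hnd A f) (rlfMap_comp_toRealification Φ hΦ f.op)

end Functor

end Literature.AlgebraicGeometry.Frobenioids
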